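import Summits.BirchSwinnertonDyer.BirchSwinnertonDyer.Theorems.TeichmullerTwistDescentTwistLatticeUnstarred
import HarnessLib

/-!
# Route `TeichmullerTwistDescent` (rev 6), LINE 11 support `NeronLatticeTwistPStarOfLowValuation`
# (stmt-BirchSwinnertonDyer-25369) — PROVED, by name

Cell `pub/bsd-wall` (D-0145 line route-BirchSwinnertonDyer-TeichmullerTwistDescent, OPEN rev 6), seat
`bsd-line-ttd-p2` (prover 2/2, g5). THEOREMS ONLY (no definition, no named fact, no `sorry`). BSD is not
proved by this; no leaf is proved by this.

* `neronLatticeTwistPStarOfLowValuation_proof : NeronLatticeTwistPStarOfLowValuation` — the item BY NAME.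
  It is the tree theorem `TeichmullerTwistDescent.neronLattice_quadraticTwist_pStar_of_lt_six`
  (`TeichmullerTwistDescentTwistLatticeUnstarred.lean`, this base g2: Stevens 1989 Lemma (5.2) at an odd
  prime `q` under `ord_q Δ_min(W) < 6` — the integral `q*`-twist model is globally minimal because
  `ord_q Δ(twist) = ord_q Δ_min(W) + 6 < 12`, so every globally minimal model `C` of `W ⊗ χ_{q*}` has
  `Λ(C) = (√q*)⁻¹ Λ(W)`), specialised from `q ≠ 2` to the item's `5 ≤ q`.
[cite: Stevens1989, Lemma (5.2) p. 96] [cite: Pal2012, Prop. 2.5 and Lemma 3.1]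
[cite: SilvermanAEC2009, VII.1 Remark 1.1, Prop. 1.3(b) and VIII.8.3]
-/

set_option autoImplicit false
-- single-conjunct summit: `Summit.BirchSwinnertonDyer.BirchSwinnertonDyer.…` repeats the name by design
set_option linter.dupNamespace false

noncomputable section

open Literature.NumberTheory.EllipticCurves.ModularForms
  Summit.BirchSwinnertonDyer.BirchSwinnertonDyer.Theses.TeichmullerTwistDescent

namespace Summit.BirchSwinnertonDyer.BirchSwinnertonDyer.Theorems.TeichmullerTwistDescent

/-- **`NeronLatticeTwistPStarOfLowValuation` (stmt-BirchSwinnertonDyer-25369) PROVED**: for `W/ℚ`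
globally minimal with Néron pair `L`, a prime `q ≥ 5` with `ord_q Δ_min(W) < 6`, any globally minimal
`C = v • W.quadraticTwist q*` with Néron pair `L'`, and `s² = q*`: `z ∈ Λ(C) ↔ s z ∈ Λ(W)`
(Stevens 1989 Lemma (5.2) shape; Pal 2012 Prop. 2.5) — the tree's
`neronLattice_quadraticTwist_pStar_of_lt_six` at `q ≠ 2`.
[cite: Stevens1989, Lemma (5.2) p. 96] [cite: Pal2012, Prop. 2.5 and Lemma 3.1] -/
theorem neronLatticeTwistPStarOfLowValuation_proof : NeronLatticeTwistPStarOfLowValuation :=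
  fun W _ _ _ hL q _ hq5 hlow C _ _ hCtw _ hL' _ hs z ↦
    neronLattice_quadraticTwist_pStar_of_lt_six W hL (by omega) hlow C hCtw hL' hs z

end Summit.BirchSwinnertonDyer.BirchSwinnertonDyer.Theorems.TeichmullerTwistDescent

end
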